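import Summits.QuantumFields.BalabanUV.T4Continuum.Support.ShellMeasurePlaquetteCubicLocatedDichEnd

/-!
# `T4Continuum.ShellMeasurePlaquetteCubicLocatedDichWitness` — REPAIR of F-ne7cleaf02g9-1, part 4: (i) AT ONE GRID
# THE REPAIRED END NEEDS NO STAR HYPOTHESIS AT ALL (every bond is a lowest-scale bond); (ii) NON-VACUITY — the repaired
# pinned (P4) END FIRES on a NONEMPTY box (d = 2, the four bonds of one plaquette, `Pl` = that plaquette, `U₀ = 1`),
# where the OLD global star hypothesis is FALSE — every binder family of the repaired END jointly inhabited in kernel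
(cell `pub-balaban`, sub-cell `t4`, spine estimate NE7c (node U5b); NE7c ROUND-2 crew, unit
`b2b-balaban-t4-ne7c-formalise-leaf-02` gen 9; FINDING F-ne7cleaf02g9-1 (journal l.18166, GAPS l.27205; owner RULING
R-ne7cp1-g32-3 l.18202: row S77 f6, conditions (1) SHAPE ∕ (2) NON-VACUITY — this file answers (2) for the dichotomy
road of parts 1–3 and records crew rule G-1's joint-inhabitation witness); ADDITIVE — imports part 3
`ShellMeasurePlaquetteCubicLocatedDichEnd` ONLY; [folklore]; data `def`s for the toy only (no `def … : Prop`),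
0 sorry, 0 citation tags)

HONEST FRAMING.  Finite four-torus programme, rung (B)+1 only — NOT infinite volume, NOT a mass gap, NOT the Clay
problem, NOT summit progress; (B), `BetaPertHyp`, (B^μ) are not consumed.  NE7c (`T4IndicatorShell.ShellWeightBound`)
is NOT PRINTED in [Balaban 1983–89] and NOT PROVED; «NE7c ⇐ the named binders» (trigger c3).  §0 is an elementary
corollary for OUR typed action; §1–§2 are a TOY MODEL certifying that OUR repaired binder shapes are jointly inhabited
with `Λ ≠ ∅`; nothing printed is asserted; nothing of Bałaban's is discharged.  HONEST DEPENDENCY (cell): continuum YM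
on T⁴ ⇐ BetaPertH ∧ nine spine estimates (0/9 proved); BetaPertH ⇐ (D1) ∧ (D4) ∧ CAP+tail; G-an2-4 gates asym, D1 and
NE2/3/4.

ONE GRID (§0).  With unit weights (`wt = W = Wf = Wd = unitW`, `wd = unitW`, `Lc = 1`) the dichotomy holds at EVERY
bond with `L_b := η⁻¹` — so **`prop4Hyp_pinned_ord₃_oneGrid_noStar`** re-makes S77 file 2's vacuous level-0 face
`prop4Hyp_pinned_ord₃_oneGrid` for ANY finite `Λ` and ANY finite set `Pl` of increasing plaquettes with boundaries in
`Λ`, with NO star hypothesis, flat ∇-datum domination as in f5b's `prop4Hyp_locGrad_cubT_oneGrid`, the explicit `η⁻¹`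
in the constant being the level-0 currency (S77's GO: «a flat one-grid version with an explicit η⁻¹ only as the level-0
instance»); `0 < η ≤ 1`.

THE TOY (§1–§2).  `d = 2`, ANY complete normed algebra `𝔸` with a tracial `τ` (e.g. `ℂ`, `id` — `id_tracial`),
`U₀ ≡ 1` (`toyU`), `η = 1`; `toyΛ` = the four bonds
`(0,0), (e₀,1), (e₁,0), (0,1)` of the unit plaquette `p₀ = p_{01}(0)`; `toyPl = {p₀}` with the `(+,+,−,−)` boundary
word `toyBd`; all weights `unitW` (`Lc = L_b = 1`: every bond is a lowest-scale bond — its star has `2(d−1) = 2`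
plaquettes of which only `p₀` is in `toyPl`); ∇-datum `covD toyΛ 1 toyU` with unit weights; `ε = 1∕4`, `ε₀ = 0`;
torus pin `T = 3`, `toyB₀ = {proj 3 0}`, `δ′ = 0`.
* `toy_nonempty`, **`toy_star_fails`** (the OLD hypothesis `∀ b, plaqStar b ⊆ toyPl` is FALSE here — by
  `ShellMeasurePlaquetteStarClosure.eq_empty_of_star_subset_of_bd` it fails on every nonempty block), `toy_dich` (the NEW
  dichotomy holds), `toy_hincr`∕`toy_hbd`∕`toy_hor`, `toy_hreg` (`U₀(∂p₀) = 1`), `toy_hDv`;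
* **`toy_fires`**: part 3's `prop4Hyp_pinned_ord₃_eta_levels_dich_torusPin` APPLIED to the toy — every hypothesis
  discharged in kernel — `Prop4Hyp (W_pin) M (1∕8)` on a nonempty block.
So the repaired END is NOT vacuous.  Nothing in the countdown moves; NE7c NOT PROVED; spine PROVED 0∕9.
-/

noncomputable section

open scoped BigOperators

namespace Summit.QuantumFields.BalabanUV.T4Continuum.ShellMeasurePlaquetteCubicLocatedDichWitness

open Literature.MathematicalPhysics.QuantumFieldTheory.Balaban1983to89
open B7Prop1Explicit (e e_apply U1)
open B8Ineq132 (covDerivFwd)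
open B11Prop6Scheme (Prop4Hyp)
open B12Decay510Torus (pl1)
open TreeLengthTorus (TPt proj)
open ShellMeasureWilsonGradientTail (plaqWord bonds)
open ShellMeasurePlaquetteTwist (plaqFunSym)
open ShellMeasureLocalGradientTailJet (ord₃)
open Summit.QuantumFields.BalabanUV.T4Continuum.ShellMeasureCommutatorVariation (plaqStar mem_plaqStar₂)
open Summit.QuantumFields.BalabanUV.T4Continuum.ShellMeasureCommutatorGradientLocal (baseSites nbhdSites)
open Summit.QuantumFields.BalabanUV.T4Continuum.ShellMeasureCommutatorLocGrad (ext)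
open Summit.QuantumFields.BalabanUV.T4Continuum.ShellMeasureCommutatorCovDatum
  (covIdx covD unitW unitW_apply norm_covDerivFwd_ext_le)
open Summit.QuantumFields.BalabanUV.T4Continuum.ShellMeasureLocalGradientTail (locGrad)
open Summit.QuantumFields.BalabanUV.T4Continuum.ShellMeasureMultiGridNorms (WSup)
open Summit.QuantumFields.BalabanUV.T4Continuum.ShellMeasureMultiGridNormsMax (WMax)
open Summit.QuantumFields.BalabanUV.T4Continuum.ShellMeasurePinnedNorm (pinW pinDist)
open Summit.QuantumFields.BalabanUV.T4Continuum.ShellMeasureWilsonRemainderLevels (etaScale)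
open Summit.QuantumFields.BalabanUV.T4Continuum.ShellMeasurePlaquetteCubicDictionary (plaqWord_zero_eq)
open Summit.QuantumFields.BalabanUV.T4Continuum.ShellMeasurePlaquetteCubicLocatedDichEnd
  (prop4Hyp_pinned_ord₃_eta_levels_dich_geom prop4Hyp_pinned_ord₃_eta_levels_dich_torusPin)

export B7Prop1Explicit (Site)

/-! ## §0 One grid: the repaired END with NO star hypothesis -/

section OneGrid

variable {d : ℕ} {𝔸 : Type*} [NormedRing 𝔸] [NormOneClass 𝔸] [NormedAlgebra ℂ 𝔸] [CompleteSpace 𝔸]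
  (Λ : Finset (Site d × Fin d)) (Pl : Finset (Fin d × Fin d × Site d)) (τ : 𝔸 →L[ℂ] ℂ)
  {U₀ : Site d → Fin d → 𝔸ˣ} (h₀ : ∀ y κ, U₀ y κ ∈ U1 𝔸) (bd : Fin d × Fin d × Site d → (Fin 4 → ↥Λ × Bool))
  {I : Type*} [Fintype I] (Dv : (↥Λ → 𝔸) →L[ℂ] (I → 𝔸))

omit [NormOneClass 𝔸] [CompleteSpace 𝔸] in
/-- FLAT ∇-DATUM DOMINATION READ WITH UNIT WEIGHTS: `‖(D^η_{U₀}ext A)(x)‖ ≤ ‖Dv A‖` (f5b's shape) gives the weighted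
domination hypothesis of the live-level ENDs at `Wd = wd = unitW`. [folklore] -/
theorem hDv_unit_of_flat {η : ℝ}
    (hDv : ∀ (A : ↥Λ → 𝔸) (y : Site d) (κ τ' : Fin d), ‖covDerivFwd η U₀ κ (fun z => ext Λ A z τ') y‖ ≤ ‖Dv A‖)
    (A : ↥Λ → 𝔸) (b : ↥Λ) (x : Site d) (κ' τ' : Fin d) (_hx : x ∈ baseSites b.1.1) :
    unitW ↥Λ b ^ 2 * ‖covDerivFwd η U₀ κ' (fun z => ext Λ A z τ') x‖ ≤ ‖(WSup.toPiL (unitW I) 2).symm (Dv A)‖ := by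
  rw [unitW_apply, one_pow, one_mul]
  refine (hDv A x κ' τ').trans ?_
  refine (pi_norm_le_iff_of_nonneg (norm_nonneg _)).2 fun i => ?_
  have h := WSup.norm_apply_le (unitW I) 2 ((WSup.toPiL (unitW I) 2).symm (Dv A)) i
  rw [unitW_apply, one_pow, one_mul, WSup.toPiL_symm_apply] at h
  exact h

include h₀ in
/-- **THE REPAIRED PINNED (P4) END AT ONE GRID — NO STAR HYPOTHESIS.**  For ANY finite bond set `Λ ⊂ ℤᵈ`, ANY finite
set `Pl` of increasing plaquettes with boundaries `bd p = ∂p` in `Λ` oriented `(+,+,−,−)`, a `U1`-valued background with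
`‖U₀(∂p) − 1‖ ≤ ε₀η²`, τ tracial, `0 < η ≤ 1`, `0 < ε`, `4ε ≤ 1`, a flat ∇-datum `Dv` dominating the covariant
derivatives, a pin (`ρ`, `posIn`, `posOut`, `ϖ ≥ 0` one-sided Lipschitz, `δ′ ≥ 0`) with stencil reach `R`, and `1 ≤ d`:
part 3's `prop4Hyp_pinned_ord₃_eta_levels_dich_geom` at unit weights with `Lc := 1`, `L_b := η⁻¹` — the dichotomy holds at
EVERY bond by its second member.  Constant `((d−1)‖τ‖(72 + 48η⁻¹((3d+2)d))·((3d+2)d) + 8κ·16d)·e^{δ′R}`,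
κ = ‖τ‖(248∕3·ε₀ + 40∕3·ε) — the level-0 currency (explicit `η⁻¹`).  Re-makes S77 file 2's vacuous
`prop4Hyp_pinned_ord₃_oneGrid` honestly. [folklore] -/
theorem prop4Hyp_pinned_ord₃_oneGrid_noStar {η : ℝ} (hη : 0 < η) (hη1 : η ≤ 1)
    (htr : ∀ P Q : 𝔸, τ (P * Q) = τ (Q * P)) (hincr : ∀ p ∈ Pl, p.1 < p.2.1)
    (hbd : ∀ p ∈ Pl, ((bd p 0).1 : Site d × Fin d) = (p.2.2, p.1) ∧ ((bd p 1).1 : Site d × Fin d) = (p.2.2 + e p.1, p.2.1)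
      ∧ ((bd p 2).1 : Site d × Fin d) = (p.2.2 + e p.2.1, p.1) ∧ ((bd p 3).1 : Site d × Fin d) = (p.2.2, p.2.1))
    (hor : ∀ p ∈ Pl, (bd p 0).2 = true ∧ (bd p 1).2 = true ∧ (bd p 2).2 = false ∧ (bd p 3).2 = false)
    (hDv : ∀ (A : ↥Λ → 𝔸) (y : Site d) (κ τ' : Fin d), ‖covDerivFwd η U₀ κ (fun z => ext Λ A z τ') y‖ ≤ ‖Dv A‖)
    {ε ε₀ : ℝ} (hε : 0 < ε) (hε₀ : 0 ≤ ε₀) (hε4 : 4 * ε ≤ 1)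
    (hreg : ∀ p ∈ Pl, ‖(plaqWord (fun b : ↥Λ => U₀ b.1.1 b.1.2) (bd p) (0 : ↥Λ → 𝔸) : 𝔸) - 1‖ ≤ ε₀ * η ^ 2)
    (hd1 : 1 ≤ d) {S : Type*} (ρ : S → S → ℝ) (posIn posOut : ↥Λ → S) (ϖ : S → ℝ) {δ' R : ℝ} (hδ' : 0 ≤ δ')
    (hϖ0 : ∀ x, 0 ≤ ϖ x) (hϖ : ∀ x y, ϖ x ≤ ϖ y + ρ x y)
    (hreach : ∀ c b : ↥Λ, b.1.1 ∈ nbhdSites c.1.1 c.1.2 → ρ (posOut c) (posIn b) ≤ R) :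
    Prop4Hyp (fun Y : WMax (fun b => unitW ↥Λ b * pinW δ' (ϖ ∘ posIn) b) (unitW I) Dv =>
        ((WSup.toPiL (fun c => unitW ↥Λ c ^ 3 * pinW δ' (ϖ ∘ posOut) c) 1).symm
          (locGrad (etaScale η (fun A : ↥Λ → 𝔸 =>
              ∑ p ∈ Pl, ord₃ (plaqFunSym τ (fun b : ↥Λ => U₀ b.1.1 b.1.2) (bd p)) A))
            (WMax.toPiL (fun b => unitW ↥Λ b * pinW δ' (ϖ ∘ posIn) b) (unitW I) Dv Y)) :
          WSup (fun c => unitW ↥Λ c ^ 3 * pinW δ' (ϖ ∘ posOut) c) 1 (𝔸 →L[ℂ] ℂ)))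
      ((((d : ℝ) - 1) * ‖τ‖ * (72 * (1 : ℝ) ^ 3 + 48 * η⁻¹ * (1 : ℝ) ^ 2 * ((3 * d + 2) * d : ℕ)) * ((3 * d + 2) * d : ℕ)
          + 8 * (‖τ‖ * (248 / 3 * ε₀ + 40 / 3 * ε)) * (1 : ℝ) ^ 4 * (4 * (4 * d : ℕ))) * Real.exp (δ' * R))
      (ε / 2) :=
  prop4Hyp_pinned_ord₃_eta_levels_dich_geom Λ Pl τ h₀ bd (unitW ↥Λ) (unitW I) Dv (unitW ↥Λ) (unitW ↥Λ)
    (unitW (Fin d × Fin d × Site d)) hη htr hincr le_rfl (inv_nonneg.2 hη.le)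
    (fun _ => Or.inr (by rw [unitW_apply, inv_mul_cancel₀ hη.ne'])) hbd hor (fun _ => one_pos)
    (fun _ _ _ => le_rfl) (fun _ => by simp) (fun _ => by simp)
    (fun A b x κ' τ' hx => hDv_unit_of_flat Λ Dv hDv A b x κ' τ' hx) hε hε₀ hε4 (fun _ _ => by simpa using hη1)
    (fun _ _ _ _ => le_rfl) (fun _ _ _ _ => by simp) (fun p hp => by simpa using hreg p hp) hd1 ρ posIn posOut ϖ
    hδ' hϖ0 hϖ hreach

end OneGrid

/-! ## §1 The toy data and their geometric binders -/

section Toy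

/-- The toy block: the four bonds of the unit plaquette `p_{01}(0)` of `ℤ²`. [folklore] -/
def toyΛ : Finset (Site 2 × Fin 2) :=
  {((0 : Site 2), (0 : Fin 2)), (e 0, (1 : Fin 2)), (e 1, (0 : Fin 2)), ((0 : Site 2), (1 : Fin 2))}

/-- The toy plaquette set: the one plaquette `p_{01}(0)`. [folklore] -/
def toyPl : Finset (Fin 2 × Fin 2 × Site 2) := {((0 : Fin 2), (1 : Fin 2), (0 : Site 2))}

/-- `toyΛ` is nonempty. [folklore] -/
theorem toy_nonempty : toyΛ.Nonempty := ⟨((0 : Site 2), (0 : Fin 2)), by simp [toyΛ]⟩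

/-- [folklore] -/
theorem mem₀ : ((0 : Site 2), (0 : Fin 2)) ∈ toyΛ := by simp [toyΛ]
/-- [folklore] -/
theorem mem₁ : (e 0, (1 : Fin 2)) ∈ toyΛ := by simp [toyΛ]
/-- [folklore] -/
theorem mem₂ : (e 1, (0 : Fin 2)) ∈ toyΛ := by simp [toyΛ]
/-- [folklore] -/
theorem mem₃ : ((0 : Site 2), (1 : Fin 2)) ∈ toyΛ := by simp [toyΛ]

/-- The toy boundary word of `p₀`: `(b₀,+), (b₁,+), (b₂,−), (b₃,−)` (the same word for every plaquette index; only `p₀`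
is in `toyPl`). [folklore] -/
def toyBd : Fin 2 × Fin 2 × Site 2 → (Fin 4 → ↥toyΛ × Bool) := fun _ =>
  ![(⟨((0 : Site 2), (0 : Fin 2)), mem₀⟩, true), (⟨(e 0, (1 : Fin 2)), mem₁⟩, true),
    (⟨(e 1, (0 : Fin 2)), mem₂⟩, false), (⟨((0 : Site 2), (1 : Fin 2)), mem₃⟩, false)]

/-- The flat toy background `U₀ ≡ 1` (in any normed algebra `𝔸`). [folklore] -/
def toyU (𝔸 : Type*) [Monoid 𝔸] : Site 2 → Fin 2 → 𝔸ˣ := fun _ _ => 1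

variable {𝔸 : Type*} [NormedRing 𝔸] [NormOneClass 𝔸] [NormedAlgebra ℂ 𝔸] [CompleteSpace 𝔸] (τ : 𝔸 →L[ℂ] ℂ)

/-- The toy pin centre: the image of the origin on the torus `(ℤ∕3)²`. [folklore] -/
def toyB₀ : Finset (TPt 2 3) := {proj 3 (0 : Site 2)}

/-- [folklore] -/
theorem toyB₀_nonempty : toyB₀.Nonempty := Finset.singleton_nonempty _

omit [NormedAlgebra ℂ 𝔸] [CompleteSpace 𝔸] in
/-- `toyU ∈ U1`. [folklore] -/
theorem toy_h₀ : ∀ (y : Site 2) (κ : Fin 2), toyU 𝔸 y κ ∈ U1 𝔸 := fun _ _ => (U1 𝔸).one_mem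

/-- `toyPl` is increasing. [folklore] -/
theorem toy_hincr : ∀ p ∈ toyPl, p.1 < p.2.1 := by
  intro p hp
  rw [toyPl, Finset.mem_singleton] at hp
  rw [hp]
  exact Fin.zero_lt_one

/-- The boundary dictionary `toyBd p₀ = ∂p₀`. [folklore] -/
theorem toy_hbd : ∀ p ∈ toyPl, ((toyBd p 0).1 : Site 2 × Fin 2) = (p.2.2, p.1)
    ∧ ((toyBd p 1).1 : Site 2 × Fin 2) = (p.2.2 + e p.1, p.2.1)
    ∧ ((toyBd p 2).1 : Site 2 × Fin 2) = (p.2.2 + e p.2.1, p.1) ∧ ((toyBd p 3).1 : Site 2 × Fin 2) = (p.2.2, p.2.1) := by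
  intro p hp
  rw [toyPl, Finset.mem_singleton] at hp
  rw [hp]
  simp [toyBd]

/-- The orientations `(+,+,−,−)`. [folklore] -/
theorem toy_hor : ∀ p ∈ toyPl, (toyBd p 0).2 = true ∧ (toyBd p 1).2 = true ∧ (toyBd p 2).2 = false
    ∧ (toyBd p 3).2 = false :=
  fun _ _ => by simp [toyBd]

/-- **THE OLD GLOBAL STAR HYPOTHESIS FAILS ON THE TOY**: the star of the bond `(0,0)` contains `p_{01}(−e₁) ∉ toyPl`.
[folklore] -/
theorem toy_star_fails : ¬ ∀ b : ↥toyΛ, plaqStar b.1.1 b.1.2 ⊆ toyPl := by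
  intro h
  have hmem : ((0 : Fin 2), (1 : Fin 2), (0 : Site 2) - e 1) ∈ plaqStar (0 : Site 2) (0 : Fin 2) :=
    mem_plaqStar₂ (by decide)
  have h' := h ⟨((0 : Site 2), (0 : Fin 2)), mem₀⟩ hmem
  rw [toyPl, Finset.mem_singleton] at h'
  have h2 := congrArg (fun q : Fin 2 × Fin 2 × Site 2 => q.2.2 1) h'
  simp [e_apply] at h2

/-- **THE NEW DICHOTOMY HOLDS ON THE TOY** (every bond at the lowest scale: weight `1 ≤ 1·η`, `η = 1`). [folklore] -/
theorem toy_dich : ∀ c : ↥toyΛ, plaqStar c.1.1 c.1.2 ⊆ toyPl ∨ unitW ↥toyΛ c ≤ 1 * 1 :=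
  fun _ => Or.inr (by simp)

omit [NormOneClass 𝔸] in
/-- The background `U₀ ≡ 1` is flat on `p₀`: `‖U₀(∂p) − 1‖ ≤ 0·(η∕W p)²`. [folklore] -/
theorem toy_hreg : ∀ p ∈ toyPl,
    ‖(plaqWord (fun b : ↥toyΛ => toyU 𝔸 b.1.1 b.1.2) (toyBd p) (0 : ↥toyΛ → 𝔸) : 𝔸) - 1‖
      ≤ 0 * ((1 : ℝ) / unitW (Fin 2 × Fin 2 × Site 2) p) ^ 2 := by
  intro p _
  rw [plaqWord_zero_eq (fun b : ↥toyΛ => toyU 𝔸 b.1.1 b.1.2) (toyBd p)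
    (by simp [toyBd]) (by simp [toyBd]) (by simp [toyBd]) (by simp [toyBd])]
  simp [toyU]

omit [NormOneClass 𝔸] [CompleteSpace 𝔸] in
/-- ∇-datum domination for the concrete ∇-datum `covD toyΛ 1 toyU` with unit weights (§0 over f5b's
`norm_covDerivFwd_ext_le`). [folklore] -/
theorem toy_hDv (A : ↥toyΛ → 𝔸) (b : ↥toyΛ) (x : Site 2) (κ' τ' : Fin 2) (hx : x ∈ baseSites b.1.1) :
    unitW ↥toyΛ b ^ 2 * ‖covDerivFwd 1 (toyU 𝔸) κ' (fun z => ext toyΛ A z τ') x‖ ≤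
      ‖(WSup.toPiL (unitW ↥(covIdx toyΛ)) 2).symm (covD (𝔸 := 𝔸) toyΛ 1 (toyU 𝔸) A)‖ :=
  hDv_unit_of_flat toyΛ (covD (𝔸 := 𝔸) toyΛ 1 (toyU 𝔸)) (fun A y κ τ => norm_covDerivFwd_ext_le toyΛ 1 (toyU 𝔸) A y κ τ)
    A b x κ' τ' hx

/-! ## §2 The repaired END fires on the toy -/

/-- **THE REPAIRED PINNED (P4) END FIRES ON A NONEMPTY BLOCK.**  Part 3's `prop4Hyp_pinned_ord₃_eta_levels_dich_torusPin`
with EVERY geometric∕weight∕regularity∕pin hypothesis discharged on the toy data (`d = 2`, `toyΛ`, `toyPl`, `toyBd`,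
`toyU ≡ 1`, `η = 1`, all weights `unitW`, `Lc = L_b = 1`, `ε = 1∕4`, `ε₀ = 0`, torus `T = 3`, `toyB₀`, `δ′ = 0`), in
ANY complete normed algebra `𝔸` with ANY tracial `τ` (e.g. `𝔸 = ℂ`, `τ = id`): `Prop4Hyp (W_pin) M (1∕8)` HOLDS — the
repaired binder shapes are JOINTLY INHABITED with `Λ ≠ ∅` (`toy_nonempty`) while the old star hypothesis is false
(`toy_star_fails`). [folklore] -/
theorem toy_fires (htr : ∀ P Q : 𝔸, τ (P * Q) = τ (Q * P)) :
    Prop4Hyp (fun Y : WMax (fun b => unitW ↥toyΛ b * pinW 0 (pinDist toyB₀ toyB₀_nonempty ∘ fun b : ↥toyΛ => proj 3 b.1.1) b)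
        (unitW ↥(covIdx toyΛ)) (covD (𝔸 := 𝔸) toyΛ 1 (toyU 𝔸)) =>
        ((WSup.toPiL (fun c => unitW ↥toyΛ c ^ 3 *
          pinW 0 (pinDist toyB₀ toyB₀_nonempty ∘ fun b : ↥toyΛ => proj 3 b.1.1) c) 1).symm
          (locGrad (etaScale 1 (fun A : ↥toyΛ → 𝔸 =>
              ∑ p ∈ toyPl, ord₃ (plaqFunSym τ (fun b : ↥toyΛ => toyU 𝔸 b.1.1 b.1.2) (toyBd p)) A))
            (WMax.toPiL (fun b => unitW ↥toyΛ b *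
              pinW 0 (pinDist toyB₀ toyB₀_nonempty ∘ fun b : ↥toyΛ => proj 3 b.1.1) b)
              (unitW ↥(covIdx toyΛ)) (covD (𝔸 := 𝔸) toyΛ 1 (toyU 𝔸)) Y)) :
          WSup (fun c => unitW ↥toyΛ c ^ 3 *
            pinW 0 (pinDist toyB₀ toyB₀_nonempty ∘ fun b : ↥toyΛ => proj 3 b.1.1) c) 1 (𝔸 →L[ℂ] ℂ)))
      (((((2 : ℕ) : ℝ) - 1) * ‖τ‖ * (72 * (1 : ℝ) ^ 3 + 48 * 1 * (1 : ℝ) ^ 2 * ((3 * 2 + 2) * 2 : ℕ))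
            * ((3 * 2 + 2) * 2 : ℕ)
          + 8 * (‖τ‖ * (248 / 3 * (0 : ℝ) + 40 / 3 * (1 / 4 : ℝ))) * (1 : ℝ) ^ 4
            * (4 * (4 * 2 : ℕ))) * Real.exp (0 * 2))
      ((1 / 4 : ℝ) / 2) :=
  prop4Hyp_pinned_ord₃_eta_levels_dich_torusPin toyΛ toyPl τ toy_h₀ toyBd
    (unitW ↥toyΛ) (unitW ↥(covIdx toyΛ)) (covD (𝔸 := 𝔸) toyΛ 1 (toyU 𝔸)) (unitW ↥toyΛ) (unitW ↥toyΛ)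
    (unitW (Fin 2 × Fin 2 × Site 2)) one_pos htr toy_hincr le_rfl zero_le_one toy_dich
    toy_hbd toy_hor (fun _ => one_pos) (fun _ _ _ => le_rfl) (fun _ => by simp) (fun _ => by simp) toy_hDv
    (by norm_num) le_rfl (by norm_num) (fun _ _ => by simp) (fun _ _ _ _ => le_rfl) (fun _ _ _ _ => by simp)
    toy_hreg (by norm_num) toyB₀ toyB₀_nonempty le_rfl

omit [NormOneClass 𝔸] [CompleteSpace 𝔸] τ in
/-- And the hypothesis of `toy_fires` is inhabited: the identity of `ℂ` is tracial. [folklore] -/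
theorem id_tracial : ∀ P Q : ℂ, ContinuousLinearMap.id ℂ ℂ (P * Q) = ContinuousLinearMap.id ℂ ℂ (Q * P) :=
  fun P Q => by simp [mul_comm]

end Toy

end Summit.QuantumFields.BalabanUV.T4Continuum.ShellMeasurePlaquetteCubicLocatedDichWitness

end
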